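import Mathlib.MeasureTheory.Function.L2Space
import Mathlib.MeasureTheory.Measure.SeparableMeasure
import Literature.Analysis.FunctionSpaces.SpaceTimeWeakCompactness
import Literature.Analysis.FunctionSpaces.TorusCalculus
import Literature.Analysis.FluidPDE.PassiveScalar
import HarnessLib

/-!
# Stub `stub_condensateWeakLimit` of the line `log-kantorovich-enstrophy-transfer`
# (crux `TwoAndHalfD.TwohalfdNeg`, stmt-AnomalousDissipation-0211; condensate theorem, Stub F)

Sorry-free discharge of the registered tool stub `stub_condensateWeakLimit` (Stub F, "weak-limit
closure") of the condensate theorem for the crux `TwohalfdNeg` (a planar Leray–Hopf family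
condensing in mean `L²` onto a smooth steady divergence-free field `V` carries no steady-source
scalar anomaly). The lead builds from each scalar a weighted Cesàro mean `Θ_j ∈ L²(T²)` with
`∫ Θ_j² ≤ C`, power `∫ Θ_j h ≥ ε` and the approximate steady transport equation
`∫ Θ_j ⟪V, ∇φ⟫ + ∫ h φ → 0` for every smooth `φ`; this file extracts a weak limit point.

**Statement.** If `Θ_j : T² → ℝ` are in `L²` with `∫ Θ_j² ≤ C`, `ε ≤ ∫ Θ_j h` for a continuous `h`,
and `∫ Θ_j ⟪V, ∇φ⟫ + ∫ h φ → 0` for every smooth `φ` (with `V` continuous), then some `Θ' ∈ L²(T²)`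
has `ε ≤ ∫ Θ' h` and solves `∫ Θ' ⟪V, ∇φ⟫ + ∫ h φ = 0` for every smooth `φ`.

**Proof.** The classes `[Θ_j] ∈ L²(T², vol)` form a bounded sequence (`‖[Θ_j]‖² = ∫ Θ_j² ≤ C`) in a
separable real Hilbert space, so by the tree's weak sequential compactness
`Literature.Analysis.FunctionSpaces.exists_strictMono_tendsto_inner_of_norm_le` (Brezis 2011,
Thm. 3.18) a subsequence `Θ_{σ j}` converges weakly to some `w ∈ L²`; `Θ'` is `w` read as a function.
Pairings of `L²` classes are integrals of products (`MeasureTheory.L2.inner_def`), and the test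
functions `h` and `x ↦ ⟪V x, ∇φ x⟫` are continuous on the compact torus, hence in `L²`; so
`∫ Θ_{σ j} h → ∫ Θ' h` gives `ε ≤ ∫ Θ' h` (`ge_of_tendsto'`), and `∫ Θ_{σ j} ⟪V, ∇φ⟫ + ∫ h φ` tends both
to `∫ Θ' ⟪V, ∇φ⟫ + ∫ h φ` and (along the subsequence) to `0`, whence the exact equation
(`tendsto_nhds_unique`).
-/

noncomputable section

namespace Summit.AnomalousDissipation.AnomalousDissipation.Theorems.TwohalfdNeg.Condensate

open MeasureTheory Filter Topology
open scoped ENNReal NNReal InnerProductSpace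
open Literature.Analysis.FunctionSpaces Literature.Analysis.FluidPDE

set_option linter.dupNamespace false

/-- The `L²(T²)` pairing of the classes of two square-integrable real functions is the integral of
their product (`MeasureTheory.L2.inner_def` read through `MemLp.coeFn_toLp`). -/
theorem condensateWeakLimit_inner_toLp {f g : UnitAddTorus (Fin 2) → ℝ} (hf : MemLp f 2 volume)
    (hg : MemLp g 2 volume) :
    inner ℝ (hf.toLp f) (hg.toLp g) = ∫ x, f x * g x := by
  rw [L2.inner_def]
  refine integral_congr_ae ?_
  filter_upwards [hf.coeFn_toLp, hg.coeFn_toLp] with x hfx hgx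
  rw [hfx, hgx, real_inner_comm, RCLike.inner_apply, conj_trivial]

/-- The `L²(T²)` norm of the class of a square-integrable real function `f` with `∫ f² ≤ C` is at
most `√C`. -/
theorem condensateWeakLimit_norm_toLp_le {f : UnitAddTorus (Fin 2) → ℝ} (hf : MemLp f 2 volume)
    {C : ℝ} (hC : ∫ x, f x ^ 2 ≤ C) :
    ‖hf.toLp f‖ ≤ Real.sqrt C := by
  have hsq : ‖hf.toLp f‖ ^ 2 ≤ C := by
    rw [← real_inner_self_eq_norm_sq, condensateWeakLimit_inner_toLp hf hf]
    refine (integral_congr_ae (Eventually.of_forall fun x => ?_)).trans_le hC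
    exact (pow_two (f x)).symm
  calc ‖hf.toLp f‖ = Real.sqrt (‖hf.toLp f‖ ^ 2) := (Real.sqrt_sq (norm_nonneg _)).symm
    _ ≤ Real.sqrt C := Real.sqrt_le_sqrt hsq

/-- **Weak limits in `L²(T²)` tested against continuous functions.** A sequence `Θ_j` of
square-integrable functions with `∫ Θ_j² ≤ C` has a subsequence `Θ_{σ j}` and a square-integrable
`Θ'` with `∫ Θ_{σ j} ψ → ∫ Θ' ψ` for every continuous `ψ` (weak sequential compactness of bounded
sequences in the separable Hilbert space `L²(T²)`,
`Literature.Analysis.FunctionSpaces.exists_strictMono_tendsto_inner_of_norm_le`; continuous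
functions on the compact torus are in `L²`). -/
theorem condensateWeakLimit_exists_subseq {Θ : ℕ → UnitAddTorus (Fin 2) → ℝ} {C : ℝ}
    (hΘ : ∀ j, MemLp (Θ j) 2 volume) (hC : ∀ j, ∫ x, Θ j x ^ 2 ≤ C) :
    ∃ σ : ℕ → ℕ, StrictMono σ ∧ ∃ Θ' : UnitAddTorus (Fin 2) → ℝ, MemLp Θ' 2 volume ∧
      ∀ ψ : UnitAddTorus (Fin 2) → ℝ, Continuous ψ →
        Tendsto (fun j => ∫ x, Θ (σ j) x * ψ x) atTop (𝓝 (∫ x, Θ' x * ψ x)) := by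
  haveI : Fact ((2 : ℝ≥0∞) ≠ ∞) := ⟨ENNReal.ofNat_ne_top⟩
  haveI : TopologicalSpace.SeparableSpace (Lp ℝ 2 (volume : Measure (UnitAddTorus (Fin 2)))) := inferInstance
  have hvM : ∀ j, ‖(hΘ j).toLp (Θ j)‖ ≤ Real.sqrt C := fun j =>
    condensateWeakLimit_norm_toLp_le (hΘ j) (hC j)
  obtain ⟨σ, hσ, w, -, hw⟩ := exists_strictMono_tendsto_inner_of_norm_le hvM
  have hwL : MemLp (w : UnitAddTorus (Fin 2) → ℝ) 2 volume := Lp.memLp w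
  have hwto : hwL.toLp (w : UnitAddTorus (Fin 2) → ℝ) = w := Lp.toLp_coeFn w (Lp.memLp w)
  refine ⟨σ, hσ, (w : UnitAddTorus (Fin 2) → ℝ), hwL, fun ψ hψ => ?_⟩
  have hψL : MemLp ψ 2 volume :=
    hψ.memLp_of_hasCompactSupport (HasCompactSupport.of_compactSpace ψ)
  have hlim : inner ℝ w (hψL.toLp ψ) = ∫ x, (w : UnitAddTorus (Fin 2) → ℝ) x * ψ x := by
    have e := condensateWeakLimit_inner_toLp hwL hψL
    rwa [hwto] at e
  have h1 : Tendsto (fun j => ∫ x, Θ (σ j) x * ψ x) atTop (𝓝 (inner ℝ w (hψL.toLp ψ))) :=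
    (hw (hψL.toLp ψ)).congr fun j => condensateWeakLimit_inner_toLp (hΘ (σ j)) hψL
  rwa [hlim] at h1

/-- **Stub F — weak-limit closure.** A sequence `Θ_j` bounded in `L²(T²)`, with `∫Θ_j h ≥ ε` and
solving the steady transport equation `div(Θ_j V) = h` up to an error tending to `0` against every
smooth test field, has a weak limit point `Θ` with `∫Θ h ≥ ε` solving it exactly (weak sequential
compactness of balls of the separable Hilbert space `L²(T²)`). [folklore] -/
theorem stub_condensateWeakLimit :
    ∀ (V : UnitAddTorus (Fin 2) → EuclideanSpace ℝ (Fin 2)) (h : UnitAddTorus (Fin 2) → ℝ)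
      (Θ : ℕ → UnitAddTorus (Fin 2) → ℝ) (C ε : ℝ),
      Continuous V → Continuous h → (∀ j, MemLp (Θ j) 2 volume) → (∀ j, ∫ x, Θ j x ^ 2 ≤ C) →
      (∀ j, ε ≤ ∫ x, Θ j x * h x) →
      (∀ φ : UnitAddTorus (Fin 2) → ℝ, Torus.IsSmooth φ →
        Tendsto (fun j => (∫ x, Θ j x * inner ℝ (V x) (Torus.gradient φ x)) + ∫ x, h x * φ x)
          atTop (𝓝 0)) →
      ∃ Θ' : UnitAddTorus (Fin 2) → ℝ, MemLp Θ' 2 volume ∧ ε ≤ ∫ x, Θ' x * h x ∧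
        ∀ φ : UnitAddTorus (Fin 2) → ℝ, Torus.IsSmooth φ →
          (∫ x, Θ' x * inner ℝ (V x) (Torus.gradient φ x)) + ∫ x, h x * φ x = 0 := by
  intro V h Θ C ε hV hh hΘ hC hε heq
  obtain ⟨σ, hσ, Θ', hΘ', hpair⟩ := condensateWeakLimit_exists_subseq hΘ hC
  refine ⟨Θ', hΘ', ge_of_tendsto' (hpair h hh) fun j => hε (σ j), fun φ hφ => ?_⟩
  have hψ : Continuous fun x => inner ℝ (V x) (Torus.gradient φ x) :=
    hV.inner hφ.gradient.continuous
  have hlim : Tendsto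
      (fun j => (∫ x, Θ (σ j) x * inner ℝ (V x) (Torus.gradient φ x)) + ∫ x, h x * φ x) atTop
      (𝓝 ((∫ x, Θ' x * inner ℝ (V x) (Torus.gradient φ x)) + ∫ x, h x * φ x)) :=
    (hpair _ hψ).add tendsto_const_nhds
  exact tendsto_nhds_unique hlim ((heq φ hφ).comp hσ.tendsto_atTop)

end Summit.AnomalousDissipation.AnomalousDissipation.Theorems.TwohalfdNeg.Condensate

end
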